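import Summits.QuantumAdvantage.AdviceFreeQNC0.SparseRead39B
import Summits.QuantumAdvantage.AdviceFreeQNC0.Pinned39C
import HarnessLib

/-!
# Cell qa-qnc0, `p = 3` — ROUND-38 §6.4.4: **(R1) at C = 0 — NEAR reads PROVED, far reads isolated**: `SparseRead39.R1OneFar ρ` for some `ρ < 1`

Planner qa-qnc0-p1 g39 (P1-39c, 2026-08-29 22:10Z).  DELTA FILE over the tree ports `SparseRead39B` (= HOME `exp39/SparseRead39.lean` v4) and
`Pinned39C` (= HOME `exp39/Pinned39.lean` v3); re-declares nothing; farm `lean check` rc 0 / 0 sorry.  PORT PLAN (three proposals, each < 400 lines):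
Part A → `SparseRead39C.lean` (namespace `SparseRead39`: `nearAt`, `TwistBoundZNearPinned`, `R1OneFar`, `affinePinned_imp_nearPinned`,
`r1OneFar_of_nearPinned`), Part B → `Pinned39D.lean` + `Pinned39E.lean` (namespace `BondTwist3`, section `NearOutputs`; split after
`sign_reassocA`), Part C → `R1OneFar39.lean` (the `Iff.rfl` bridge + the assembly, exactly as `R1Zero39.lean`).

CONTENT.  (R1) at `C = 0` (`|T k ∖ W| ≤ 1`: every output reads `x|_W` and at most ONE outside letter `i k`) in the strong form `R1One ρ`
(constant `A`, all `W`, all `N`) was reduced in `SparseRead39B` to the affine pinned bound `TwistBoundZAffinePinned ρ`.  Here: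
* Part A: its NEAR part `TwistBoundZNearPinned ρ` (reader maps with `i k ∈ {k − 1, k, k + 1}` cyclically) implies **`R1OneFar ρ`** — (R1) at
  `C = 0` with the FAR-read twisted letters exempted from the exponent (they are moved into the pin set, which is exact: `norm_pinSum_le_of_oneLetter`).
* Part B: **`BondTwist3.twistBoundZNearPinned : ∃ ρ, 0 ≤ ρ ∧ ρ < 1 ∧ TwistBoundZNearPinned ρ`** — a read of letter `j` by bell `j`, `j − 1` or
  `j + 1` is a SIGN PATTERN of the `r = 0` chain (`liveCur`, `livePrev`, `liveNext = liveCur ∘ nextState`), and `SiteContracts` is uniform over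
  sign patterns; the v3 chain of `Pinned39B/C` made generic in the per-letter sign (`WG`, `fG`, `pointwise_eqG`, `core_boundG`, `main_boundG`).
* Part C: **`SparseRead39.r1OneFar : ∃ ρ, 0 ≤ ρ ∧ ρ < 1 ∧ R1OneFar ρ`**: every `C = 0` strategy `g k x = G_k(x|_W, x_{i k})` obeys
  `‖Σ_x e₃(β·x)[OddZeros x ∧ Rel x (g x)]‖ ≤ A·ρ^{#{j ∉ W : β_j ≠ 0, j not far-read}}·2^N` — in particular (R1) at `C = 0` with FULL exponent for
  every strategy whose outside reads are near, for all `W` and `N`.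

WHAT THIS IS NOT: the far-read twisted letters (`|i k − k| ≥ 2`) are not shown to decay (`TwistBoundZAffinePinned` stays open: ROUND-38 §6.4.4(c),(d),
ask A39-9); `C ≥ 1` untouched; crux 22907 untouched; no separation claim.  Custody D-0168 E1: HOME file, nothing proposed by this seat.
-/

noncomputable section

namespace Summit.QuantumAdvantage.AdviceFreeQNC0

open Finset Literature.Computability.QuantumComplexity Literature.Computability.MetaComplexity

/-! ## Part A (→ `SparseRead39C.lean`): the near/far split of the `C = 0` reduction -/

namespace SparseRead39

open scoped Classical

variable {N : ℕ}

/-! ### The fixed-reader-map form of `norm_pinSum_le_of_oneLetter` (HOME v5; the tree's v4 form quantifies the hypothesis over all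
reader maps, which the NEAR bound does not supply) -/

/-- **Main lemma (lossless, one outside letter)**: under the affine pinned hypothesis with constant `A`, for disjoint `W`, `P`,
every one-letter strategy over `W`: `‖pinSum β P ξ g‖ ≤ A·ρ^{#{j ∉ W ∪ P : β_j ≠ 0}}·2^{N − #P}`. -/
theorem norm_pinSum_le_of_oneLetterFixed {ρ A : ℝ} (i : Fin N → Fin N)
    (hA : ∀ (P : Finset (Fin N)) (ξ b c : Fin N → Bool) (β : Fin N → ZMod 3),
      ‖pinSum β P ξ (affOut b c i)‖
        ≤ A * ρ ^ (univ.filter fun j : Fin N => j ∉ P ∧ β j ≠ 0).card * (2 : ℝ) ^ (N - P.card))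
    (W : Finset (Fin N)) :
    ∀ (P : Finset (Fin N)), Disjoint W P → ∀ (g : Fin N → (Fin N → Bool) → Bool),
      (∀ k (x x' : Fin N → Bool), (∀ j ∈ W, x j = x' j) → x (i k) = x' (i k) → g k x = g k x') →
        ∀ (ξ : Fin N → Bool) (β : Fin N → ZMod 3),
          ‖pinSum β P ξ g‖
            ≤ A * ρ ^ (univ.filter fun j : Fin N => (j ∉ W ∧ j ∉ P) ∧ β j ≠ 0).card * (2 : ℝ) ^ (N - P.card) := by
  induction W using Finset.induction_on with
  | empty =>
    intro P _ g hg ξ β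
    have e : (univ.filter fun j : Fin N => (j ∉ (∅ : Finset (Fin N)) ∧ j ∉ P) ∧ β j ≠ 0)
        = (univ.filter fun j : Fin N => j ∉ P ∧ β j ≠ 0) := by
      ext j; simp
    rw [affine_of_oneLetter_empty hg, e]
    exact hA P ξ _ _ β
  | @insert a W haW ih =>
    intro P hdis g hg ξ β
    have haP : a ∉ P := Finset.disjoint_left.mp hdis (mem_insert_self a W)
    have hdis' : Disjoint W (insert a P) := by
      rw [Finset.disjoint_insert_right]
      exact ⟨haW, (Finset.disjoint_insert_left.mp hdis).2⟩
    have e : ∀ c : Bool, (univ.filter fun j : Fin N => (j ∉ W ∧ j ∉ insert a P) ∧ β j ≠ 0)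
        = (univ.filter fun j : Fin N => (j ∉ insert a W ∧ j ∉ P) ∧ β j ≠ 0) := by
      intro c; ext j; simp only [mem_filter, mem_univ, true_and, mem_insert, not_or]; tauto
    have hcardP : (insert a P).card = P.card + 1 := Finset.card_insert_of_notMem haP
    have hPN : P.card + 1 ≤ N := by
      have := Finset.card_le_univ (insert a P); rw [hcardP, Fintype.card_fin] at this; exact this
    have hc : ∀ c : Bool, ‖pinSum β (insert a P) (Function.update ξ a c) (restrictAt g a c)‖
        ≤ A * ρ ^ (univ.filter fun j : Fin N => (j ∉ insert a W ∧ j ∉ P) ∧ β j ≠ 0).card * (2 : ℝ) ^ (N - (P.card + 1)) := by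
      intro c
      have h := ih (insert a P) hdis' (restrictAt g a c) (restrictAt_oneLetter hg c) (Function.update ξ a c) β
      rw [e c, hcardP] at h
      exact h
    calc ‖pinSum β P ξ g‖
        = ‖∑ c : Bool, pinSum β (insert a P) (Function.update ξ a c) (restrictAt g a c)‖ := by
          rw [pinSum_split β P ξ g a haP]
      _ ≤ ∑ c : Bool, ‖pinSum β (insert a P) (Function.update ξ a c) (restrictAt g a c)‖ := norm_sum_le _ _
      _ ≤ ∑ _c : Bool, A * ρ ^ (univ.filter fun j : Fin N => (j ∉ insert a W ∧ j ∉ P) ∧ β j ≠ 0).card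
            * (2 : ℝ) ^ (N - (P.card + 1)) := Finset.sum_le_sum fun c _ => hc c
      _ = A * ρ ^ (univ.filter fun j : Fin N => (j ∉ insert a W ∧ j ∉ P) ∧ β j ≠ 0).card * (2 : ℝ) ^ (N - P.card) := by
          rw [Fintype.sum_bool]
          have hN : N - P.card = (N - (P.card + 1)) + 1 := by omega
          rw [hN, pow_succ]; ring

/-! ### v5: NEAR versus FAR reads (ROUND-38 §6.4.4)

A reader map is NEAR at bell `k` if its outside letter is one of `k − 1, k, k + 1` (cyclically): then the liveness of bell `k` is a
function of the `r = 0` walk state at the letter's site and the read is absorbed into the sign pattern of the chain (§6.4.4(b)); the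
near-restricted affine pinned bound `TwistBoundZNearPinned` is the r = 0 chain's reach.  FAR-read letters can always be pinned
(§6.4.4(c1)), so the near bound already gives `(R1)₁` UP TO THE FAR-READ TWISTED LETTERS: `r1OneFar_of_nearPinned` (PROVED) —
the exponent counts every twisted letter outside `W` that is not read from afar.  The decay contributed by far-read twisted letters is
the open content of `(R1)₁` (§6.4.4(c),(d)). -/

/-- Bell `k` reads NEAR: its outside letter `i k` is `k`, `k + 1` or `k − 1` (mod `N`). -/
def nearAt (i : Fin N → Fin N) (k : Fin N) : Prop :=
  (i k).val = k.val ∨ (i k).val = (k.val + 1) % N ∨ k.val = ((i k).val + 1) % N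

/-- **Conjecture `TwistBoundZNearPinned ρ`** = `TwistBoundZAffinePinned` restricted to NEAR reader maps (the r = 0 chain's reach, A39-8). -/
def TwistBoundZNearPinned (ρ : ℝ) : Prop :=
  ∃ A : ℝ, ∀ (N : ℕ) (P : Finset (Fin N)) (ξ b c : Fin N → Bool) (i : Fin N → Fin N), (∀ k, nearAt i k) →
    ∀ (β : Fin N → ZMod 3),
      ‖pinSum β P ξ (affOut b c i)‖
        ≤ A * ρ ^ (univ.filter fun j : Fin N => j ∉ P ∧ β j ≠ 0).card * (2 : ℝ) ^ (N - P.card)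

/-- **`(R1)₁` up to far reads = `R1OneFar ρ`**: every one-outside-letter strategy obeys the (R1) bound with exponent = the twisted letters
outside `W` that are NOT read from afar (`j ≠ i k` for every far-reading bell `k`). -/
def R1OneFar (ρ : ℝ) : Prop :=
  ∃ A : ℝ, ∀ (N : ℕ) (W : Finset (Fin N)) (i : Fin N → Fin N) (g : Fin N → (Fin N → Bool) → Bool),
    (∀ k (x x' : Fin N → Bool), (∀ j ∈ W, x j = x' j) → x (i k) = x' (i k) → g k x = g k x') →
      ∀ β : Fin N → ZMod 3,
        ‖∑ x : Fin N → Bool, (ZMod.stdAddChar (∑ j : Fin N, if x j then β j else 0) : ℂ) *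
            (if (OddZeros x ∧ RingHLF.Rel x (fun k => g k x)) then (1 : ℂ) else 0)‖
          ≤ A * ρ ^ (univ.filter fun j : Fin N => j ∉ W ∧ ¬ (∃ k, ¬ nearAt i k ∧ i k = j) ∧ β j ≠ 0).card * (2 : ℝ) ^ N

/-- auxiliary lemma `affinePinned_imp_nearPinned` (planner p1 g39, exp39; ported verbatim). -/
theorem affinePinned_imp_nearPinned {ρ : ℝ} (h : TwistBoundZAffinePinned ρ) : TwistBoundZNearPinned ρ := by
  obtain ⟨A, hA⟩ := h
  exact ⟨A, fun N P ξ b c i _ β => hA N P ξ b c i β⟩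

/-- **`r1OneFar_of_nearPinned`**: pin the far-read letters (lossless in the constant) and re-point far-reading bells to themselves. -/
theorem r1OneFar_of_nearPinned {ρ : ℝ} (h : TwistBoundZNearPinned ρ) : R1OneFar ρ := by
  obtain ⟨A, hA⟩ := h
  refine ⟨A, fun N W i g hg β => ?_⟩
  -- far-read letters and the re-pointed (near) reader map
  set Rfar : Finset (Fin N) := univ.filter fun j : Fin N => ∃ k, ¬ nearAt i k ∧ i k = j with hRfar
  set i' : Fin N → Fin N := fun k => if nearAt i k then i k else k with hi'
  have hnear : ∀ k, nearAt i' k := by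
    intro k
    by_cases hk : nearAt i k
    · have e : i' k = i k := by simp [hi', hk]
      unfold nearAt; rw [e]; exact hk
    · have e : i' k = k := by simp [hi', hk]
      unfold nearAt; rw [e]; exact Or.inl rfl
  have hg' : ∀ k (x x' : Fin N → Bool), (∀ j ∈ W ∪ Rfar, x j = x' j) → x (i' k) = x' (i' k) → g k x = g k x' := by
    intro k x x' hW hik
    refine hg k x x' (fun j hj => hW j (Finset.mem_union_left _ hj)) ?_
    by_cases hk : nearAt i k
    · have e : i' k = i k := by simp [hi', hk]
      rw [← e]; exact hik
    · refine hW (i k) (Finset.mem_union_right _ ?_)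
      rw [hRfar, Finset.mem_filter]; exact ⟨Finset.mem_univ _, k, hk, rfl⟩
  have h1 := norm_pinSum_le_of_oneLetterFixed (N := N) i' (fun P ξ b c β' => hA N P ξ b c i' hnear β') (W ∪ Rfar) ∅
    (Finset.disjoint_empty_right _) g hg' (fun _ => false) β
  have hpin : ∀ x : Fin N → Bool, pinInd (∅ : Finset (Fin N)) (fun _ => false) x = 1 := by
    intro x; unfold pinInd; simp
  have hrw : pinSum β ∅ (fun _ => false) g = ∑ x : Fin N → Bool,
      (ZMod.stdAddChar (∑ j : Fin N, if x j then β j else 0) : ℂ) *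
        (if (OddZeros x ∧ RingHLF.Rel x (fun k => g k x)) then (1 : ℂ) else 0) := by
    unfold pinSum
    refine Finset.sum_congr rfl fun x _ => ?_
    rw [hpin x, one_mul]; rfl
  have e : (univ.filter fun j : Fin N => (j ∉ W ∪ Rfar ∧ j ∉ (∅ : Finset (Fin N))) ∧ β j ≠ 0)
      = (univ.filter fun j : Fin N => j ∉ W ∧ ¬ (∃ k, ¬ nearAt i k ∧ i k = j) ∧ β j ≠ 0) := by
    ext j
    simp only [hRfar, Finset.mem_filter, Finset.mem_univ, true_and, Finset.mem_union, not_or, Finset.notMem_empty,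
      not_false_eq_true, and_true, and_assoc]
  rw [hrw, e, Finset.card_empty, Nat.sub_zero] at h1
  exact h1


end SparseRead39

end Summit.QuantumAdvantage.AdviceFreeQNC0
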